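import Summits.BirchSwinnertonDyer.BirchSwinnertonDyer.Theorems.SignedBaseChangeAnticyclotomicEisensteinDivisibilityAdmdefRankOneFinrank
import Summits.BirchSwinnertonDyer.BirchSwinnertonDyer.Theorems.SignedBaseChangeAnticyclotomicEisensteinDivisibilityAdmdefRamifiedBaseChange
import Literature.NumberTheory.EllipticCurves.MultiplicativeUnramifiedTorsionProofs
import Literature.NumberTheory.EllipticCurves.NeronComponentIndexSplitProofs
import Literature.NumberTheory.EllipticCurves.PastenValuationProductThm115Proofs
import Literature.NumberTheory.EllipticCurves.TamagawaFiniteIndexProofs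
import Literature.RingTheory.DiscreteValuationRing.AdicCompletionResidueField
import HarnessLib

/-!
# Line `admdef` (crux `AnticyclotomicEisensteinDivisibility`, stmt-BirchSwinnertonDyer-20727), rigidity road: the Tamagawa hypothesis (Tam)
# «`p ∤ c_v(E/K)` at the bad `v ∤ p`» DISCHARGED on the all-ramified cell — Howard's criterion at the root mod `𝔪` with (Tam) GONE

LEAD seat bsd-line-sbc-p1 (gen 30), `--supports stmt-BirchSwinnertonDyer-20727` (helper; OFF the v23 composition path).  Gen 29 landed Howard's
criterion at the root modulo `𝔪` for CHKLL25's signed bipartite systems on the all-ramified cell with every hypothesis standard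
(`…AdmdefRankOneTamagawa`, `…AdmdefRankOneFinrank`), among them the printed hypothesis (Tam) of Hatley–Lei–Vigni 2022 §1.2 «`p ∤ c_v(E/K)` at every
bad place `v ∤ p`», and REMARKED that on the all-ramified cell with `p ≥ 5` (Tam) is automatic in print.  THIS FILE proves that remark in kernel, from
theorems already in the tree (no Tate curve is needed beyond what the tree proved):

* §1 `not_dvd_localTamagawaNumber_of_exists_inertia_smul_ne` — for an elliptic curve `E` over a number field `K`, a prime `p ≥ 5` and a finite place
  `v ∤ p` at which `E[p]` is RAMIFIED (some element of the inertia group of some prime of `K̄` above `v` moves a point of `E[p]`): **`p ∤ c_v(E/K)`**.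
  Dichotomy on the reduction type of the local minimal model: split multiplicative ⟹ `c_v = ord_v(Δ_min)` (Kodaira–Néron, Silverman *ATAEC* IV.9.2(d),
  tree `localTamagawaNumber_eq_ordMinimalDiscriminant_of_hasSplitMultiplicativeReductionAt`) and `p ∣ ord_v(Δ_min)` would make `E[p]` UNRAMIFIED at `v`
  (Serre 1972 n° 1.12, the unramified half of the Tate-curve criterion, tree `smul_geomTorsion_eq_of_mem_inertia_of_hasMultiplicativeReductionAt_of_dvd`,
  proved there from Kodaira–Néron over `K_v^nr`); otherwise `1 ≤ c_v ≤ 4 < 5 ≤ p` (Kodaira–Néron bound, tree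
  `localTamagawaNumber_le_four_of_not_hasSplitMultiplicativeReduction`, and `c_v ≠ 0`, tree `localTamagawaNumber_baseChange_ne_zero`).
* §2 `not_dvd_localTamagawaNumber_of_allRamified` — (Tam) for `E/K` VERBATIM as `…AdmdefRankOneTamagawa` consumes it, from `[K : ℚ] = 2`, `N = N_E`,
  `(N, d_K) = 1`, `p ≥ 5` and binder (ii) «`E[p]` ramified at every `q ∣ N`» (the `ℚ → K` inertia transfer is gen 28's
  `forall_exists_inertia_smul_ne_baseChange_of_allRamified`).
* §3 `limitBaseClass_layer_zero_one_ne_zero_of_hasUnitLambda_of_selmerGroup_line'`, `…_of_finrank_eq_one'` — **Howard 2006 Thm. 3.2.3 (c) at the ROOT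
  mod `𝔪` on the all-ramified cell with (Tam) REMOVED**: [NV] `B.HasUnitLambda N` + `AcSigned.Setting` + the named print fact {Hatley–Lei–Vigni 2022
  Lemma 3.7, local form} + binder (ii) + `(N, d_K) = 1` + `p ≥ 5`, `ρ̄_{E,p}` onto, Heegner, `p` split + rank one (`Sel_p(E/K) = ℤ·s`, resp.
  `finrank (ZMod p) Sel_p(E/K)[p] = 1`) ⟹ `z_{0,1} ≠ 0`.

HONEST FRAMING: theorems only (no definition, no named fact, no `sorry`); the HLV named fact stays a HYPOTHESIS (conditional result); nothing about the
crux, the anchors (K1) or BSD is asserted; no summit statement is proved.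

References: [cite: SilvermanATAEC1994, Cor. IV.9.2(d) (PDF p. 340), V.6 Prop. 6.1, Ex. 5.13(b)] [cite: SerreInventiones1972, n° 1.12] [cite: Serre1987, §4.1 (4.1.12)]
[cite: SilvermanAEC2009, Cor. VII.6.2] [cite: HatleyLeiVigni2022, §1.2 (Tam), Lemma 3.7] [cite: Howard2006, Thm. 3.2.3 (c)]
[cite: CastellaEtAl2025, Thm. 7.1 (ii), Thm. 7.4, Thm. 7.5 (arXiv:2308.10474v2 pp. 29–31)].
-/

-- D-0017: single-problem summit, the namespace repeats the problem name by design.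
set_option linter.dupNamespace false
set_option autoImplicit false

noncomputable section

open scoped Classical NumberField Pointwise

namespace Summit.BirchSwinnertonDyer.BirchSwinnertonDyer.Theorems.SignedBaseChangeAcDivAdmdefTamagawaOfAllRamified

open WeierstrassCurve NumberField IsDedekindDomain Field Module
open Literature.NumberTheory.EllipticCurves Literature.NumberTheory.GaloisRepresentations
open Literature.NumberTheory.EllipticCurves.CastellaHsuKunduLeeLiu2025
open Literature.NumberTheory.EllipticCurves.BertoliniDarmon2005
open Literature.NumberTheory.EllipticCurves.AcSigned
open Summit.BirchSwinnertonDyer.BirchSwinnertonDyer.Theorems.AdditiveKoly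
open Summit.BirchSwinnertonDyer.BirchSwinnertonDyer.Theorems.SignedBaseChangeAcDivAdmdefCoreRootOfSeenAnchor
open Summit.BirchSwinnertonDyer.BirchSwinnertonDyer.Theorems.SignedBaseChangeAcDivAdmdefRamifiedBaseChange
open Summit.BirchSwinnertonDyer.BirchSwinnertonDyer.Theorems.SignedBaseChangeAcDivAdmdefRankOneTamagawa
open Summit.BirchSwinnertonDyer.BirchSwinnertonDyer.Theorems.SignedBaseChangeAcDivAdmdefRankOneFinrank

universe u

/-! ## §1 A ramified `E[p]` at `v ∤ p`, `p ≥ 5`, forces `p ∤ c_v` -/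

section Local

variable {K : Type} [Field K] [NumberField K] (E : WeierstrassCurve K) [E.IsElliptic] {p : ℕ}

/-- **`E[p]` ramified at `v ∤ p` with `p ≥ 5` ⟹ `p ∤ c_v(E/K)`.**  For an elliptic curve `E` over a number field `K`, a prime `p ≥ 5` and a finite
place `v ∤ p` such that some element of the inertia group of some prime of `K̄` above `v` moves a point of `E[p] = E(K̄)[p]`, the local Tamagawa
number `c_v = [E(K_v) : E₀(K_v)]` is prime to `p`.  Split multiplicative reduction: `c_v = ord_v(Δ_min)` (Kodaira–Néron) and `p ∣ ord_v(Δ_min)` would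
make the inertia groups above `v` act trivially on `E[p]` (Serre 1972 n° 1.12, the tree's Tate-free proof); otherwise `0 < c_v ≤ 4 < p`.
[cite: SilvermanATAEC1994, Cor. IV.9.2(d) (PDF p. 340)] [cite: SerreInventiones1972, n° 1.12] [cite: SilvermanAEC2009, Cor. VII.6.2] -/
theorem not_dvd_localTamagawaNumber_of_exists_inertia_smul_ne (hp : p.Prime) (h5 : 5 ≤ p) (v : HeightOneSpectrum (𝓞 K))
    (hpv : ((p : ℕ) : 𝓞 K) ∉ v.asIdeal)
    (hram : ∃ 𝔔 ∈ v.primesAbove, ∃ τ ∈ 𝔔.inertia (absoluteGaloisGroup K), ∃ P : geomTorsion E (p : ℤ), τ • P ≠ P) :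
    ¬ p ∣ (E.baseChange (v.adicCompletion K)).localTamagawaNumber (v.adicCompletionIntegers K) := by
  intro hdvd
  by_cases hs : E.HasSplitMultiplicativeReductionAt v
  · -- split multiplicative: `c_v = ord_v(Δ_min)`, so `p ∣ ord_v(Δ_min)` and `E[p]` is unramified at `v`
    rw [localTamagawaNumber_eq_ordMinimalDiscriminant_of_hasSplitMultiplicativeReductionAt v E hs] at hdvd
    obtain ⟨𝔔, h𝔔, τ, hτ, P, hP⟩ := hram
    exact hP (E.smul_geomTorsion_eq_of_mem_inertia_of_hasMultiplicativeReductionAt_of_dvd hs.hasMultiplicativeReductionAt hp hpv hdvd h𝔔 hτ P)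
  · -- not split multiplicative: `0 < c_v ≤ 4 < 5 ≤ p`
    haveI : Finite (IsLocalRing.ResidueField (v.adicCompletionIntegers K)) :=
      HeightOneSpectrum.finite_residueField_adicCompletionIntegers K v
    haveI : PerfectField (IsLocalRing.ResidueField (v.adicCompletionIntegers K)) := PerfectField.ofFinite
    haveI : (E.baseChange (v.adicCompletion K)).IsElliptic := by
      unfold WeierstrassCurve.baseChange; infer_instance
    have hle : (E.baseChange (v.adicCompletion K)).localTamagawaNumber (v.adicCompletionIntegers K) ≤ 4 :=
      localTamagawaNumber_le_four_of_not_hasSplitMultiplicativeReduction (v.adicCompletionIntegers K) _ hs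
    have hne : (E.baseChange (v.adicCompletion K)).localTamagawaNumber (v.adicCompletionIntegers K) ≠ 0 :=
      E.localTamagawaNumber_baseChange_ne_zero v
    have hle' := Nat.le_of_dvd (Nat.pos_of_ne_zero hne) hdvd
    omega

end Local

/-! ## §2 (Tam) on the all-ramified cell -/

section AllRamified

variable (W : WeierstrassCurve ℚ) [W.IsElliptic] {K : Type} [Field K] [NumberField K]

/-- **(Tam) «`p ∤ c_v(E/K)` at every bad `v ∤ p`» on the all-ramified cell** — exactly the hypothesis `htam` of `…AdmdefRankOneTamagawa` ∕
`…AdmdefRankOneFinrank`.  For `E/ℚ` elliptic with `N = N_E`, `K` quadratic with `(N, d_K) = 1`, `p ≥ 5` prime and binder (ii) of C⁺⁺ («`E[p]` ramified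
at every `q ∣ N`»): at every bad place `v ∤ p` of `E/K` the local Tamagawa number `c_v(E/K)` is prime to `p`.  (Gen 28's `ℚ → K` inertia transfer
`forall_exists_inertia_smul_ne_baseChange_of_allRamified` makes `E_K[p]` ramified at `v`; then §1.)  This is the sentence «(Tam) is automatic on the
all-ramified cell for `p ≥ 5`» of Hatley–Lei–Vigni's setting read through CHKLL25 Thm. 7.1 (ii).
[cite: HatleyLeiVigni2022, §1.2 (Tam)] [cite: CastellaEtAl2025, Thm. 7.1 (ii) (arXiv:2308.10474v2 p. 29)] [cite: SilvermanATAEC1994, Cor. IV.9.2(d)] -/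
theorem not_dvd_localTamagawaNumber_of_allRamified (hK2 : Module.finrank ℚ K = 2) {p : ℕ} (hp : p.Prime) (h5 : 5 ≤ p)
    {N : ℕ} (hN : (N : ℤ) = W.conductorNorm ℤ) (hND : IsCoprime (N : ℤ) (NumberField.discr K))
    (hall : ∀ q : ℕ, q.Prime → q ∣ N → ∃ v' : HeightOneSpectrum (𝓞 ℚ), ((q : ℕ) : 𝓞 ℚ) ∈ v'.asIdeal ∧
      ∃ 𝔓 ∈ v'.primesAbove, ∃ σ ∈ 𝔓.inertia (absoluteGaloisGroup ℚ), ∃ P : W.geomTorsion (p : ℤ), σ • P ≠ P) :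
    ∀ v : HeightOneSpectrum (𝓞 K), ¬ (W.baseChange K).HasGoodReductionAt v → ((p : ℕ) : 𝓞 K) ∉ v.asIdeal →
      ¬ p ∣ ((W.baseChange K).baseChange (v.adicCompletion K)).localTamagawaNumber (v.adicCompletionIntegers K) := by
  intro v hbad hpv
  haveI : (W.baseChange K).IsElliptic := by unfold WeierstrassCurve.baseChange; infer_instance
  have hram := forall_exists_inertia_smul_ne_baseChange_of_allRamified W hK2 hN hND hall v hbad hpv
  rw [pow_one] at hram
  exact not_dvd_localTamagawaNumber_of_exists_inertia_smul_ne (W.baseChange K) hp h5 v hpv hram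

end AllRamified

/-! ## §3 Howard's criterion at the root mod `𝔪` on the all-ramified cell — (Tam) removed -/

section Assembly

variable {K : Type} [Field K] [NumberField K] {W : WeierstrassCurve ℚ} [W.IsElliptic] [W.IsGloballyMinimal] {p : ℕ} [Fact p.Prime]
  {κ : ZpExtension K p} {γ : absoluteGaloisGroup K} {N : ℕ} {ε : ℤˣ} {B : SignedBipartiteSystem W K p κ} {𝔭 𝔭' : HeightOneSpectrum (𝓞 K)}

/-- **Howard's criterion at the root modulo `𝔪` on the all-ramified cell, (Tam) discharged.**  For a signed bipartite system `B` of sign `ε` at level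
`N = N_E` (CHKLL25 Thm. 7.4) with limit base class `z`, on the frame (`AcSigned.Setting`; `p ≥ 5`, `ρ̄_{E,p}` onto, Heegner, `p` split, `(N, d_K) = 1`),
GIVEN the named print fact {Hatley–Lei–Vigni 2022 Lemma 3.7, local form}, binder (ii) «`E[p]` ramified at every `q ∣ N`» and [NV] `B.HasUnitLambda N`:
if the classical `p`-Selmer group `Sel_p(E/K) ⊆ H¹(K, E[p])` is a line `ℤ·s`, `s ≠ 0`, then **`z_{0,1} ≠ 0`**.
(`…RankOneTamagawa.limitBaseClass_layer_zero_one_ne_zero_of_hasUnitLambda_of_selmerGroup_line_of_tam` with (Tam) supplied by §2; `[K : ℚ] = 2` from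
the `Setting`.) [cite: Howard2006, Thm. 3.2.3 (c)] [cite: CastellaEtAl2025, Thm. 7.1 (ii), Thm. 7.4, Thm. 7.5 (arXiv:2308.10474v2 pp. 29–31)]
[cite: HatleyLeiVigni2022, Lemma 3.7] -/
theorem limitBaseClass_layer_zero_one_ne_zero_of_hasUnitLambda_of_selmerGroup_line' (hB : IsSignedBipartiteSystem W K p κ γ N ε B)
    {z : Π n j : ℕ, (W.baseChange K).torsionH1Over ((p : ℤ) ^ j) (κ.layerSubgroup n)} (hz : B.IsLimitBaseClass z)
    (hS : Setting W K p κ 𝔭 𝔭') (hloc : hatleyLeiVigni2022_lemma37_local_signedCondition_eq_kummer W K p κ 𝔭 𝔭')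
    (hN : (N : ℤ) = W.conductorNorm ℤ) (h5 : 5 ≤ p) (hsurj : W.HasSurjectiveModNGaloisRep p)
    (hH : SatisfiesHeegnerHypothesis (W.conductorNorm ℤ) K) (hsp : ((Ideal.span {(p : ℤ)}).primesOver (𝓞 K)).ncard = 2)
    (hND : IsCoprime (N : ℤ) (NumberField.discr K))
    (hall : ∀ q : ℕ, q.Prime → q ∣ N → ∃ v' : HeightOneSpectrum (𝓞 ℚ), ((q : ℕ) : 𝓞 ℚ) ∈ v'.asIdeal ∧
      ∃ 𝔓 ∈ v'.primesAbove, ∃ σ ∈ 𝔓.inertia (absoluteGaloisGroup ℚ), ∃ P : W.geomTorsion (p : ℤ), σ • P ≠ P)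
    {s : Vp W K p} (hs : s ∈ selmerGroup (W.baseChange K) ((p ^ 1 : ℕ) : ℤ)) (hs0 : s ≠ 0)
    (hline : ∀ c ∈ selmerGroup (W.baseChange K) ((p ^ 1 : ℕ) : ℤ), ∃ a : ℤ, c = a • s)
    (hNV : B.HasUnitLambda N) : z 0 1 ≠ 0 :=
  limitBaseClass_layer_zero_one_ne_zero_of_hasUnitLambda_of_selmerGroup_line_of_tam hB hz hS hloc
    (not_dvd_localTamagawaNumber_of_allRamified W hS.isImaginaryQuadratic.1 (Fact.out : p.Prime) h5 hN hND hall)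
    hN h5 hsurj hH hsp hND hall hs hs0 hline hNV

/-- **Howard's criterion at the root modulo `𝔪` on the all-ramified cell, rank one as `finrank (ZMod p) Sel_p(E/K)[p] = 1`, (Tam) discharged** —
the line's own currency ((RV₁)H ∕ (RV₁)H-pinned): [NV] `B.HasUnitLambda N` + `AcSigned.Setting` + {Hatley–Lei–Vigni 2022 Lemma 3.7, local form
(named fact)} + binder (ii) + `(N, d_K) = 1` + `p ≥ 5`, `ρ̄` onto, Heegner, `p` split + `finrank (ZMod p) Sel_p(E/K)[p] = 1` ⟹ **`z_{0,1} ≠ 0`**.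
(`…RankOneFinrank.limitBaseClass_layer_zero_one_ne_zero_of_hasUnitLambda_of_finrank_eq_one` with (Tam) supplied by §2.)
[cite: Howard2006, Thm. 3.2.3 (c)] [cite: CastellaEtAl2025, Thm. 7.1 (ii), Thm. 7.4, Thm. 7.5 (arXiv:2308.10474v2 pp. 29–31)] [cite: HatleyLeiVigni2022, Lemma 3.7] -/
theorem limitBaseClass_layer_zero_one_ne_zero_of_hasUnitLambda_of_finrank_eq_one' (hB : IsSignedBipartiteSystem W K p κ γ N ε B)
    {z : Π n j : ℕ, (W.baseChange K).torsionH1Over ((p : ℤ) ^ j) (κ.layerSubgroup n)} (hz : B.IsLimitBaseClass z)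
    (hS : Setting W K p κ 𝔭 𝔭') (hloc : hatleyLeiVigni2022_lemma37_local_signedCondition_eq_kummer W K p κ 𝔭 𝔭')
    (hN : (N : ℤ) = W.conductorNorm ℤ) (h5 : 5 ≤ p) (hsurj : W.HasSurjectiveModNGaloisRep p)
    (hH : SatisfiesHeegnerHypothesis (W.conductorNorm ℤ) K) (hsp : ((Ideal.span {(p : ℤ)}).primesOver (𝓞 K)).ncard = 2)
    (hND : IsCoprime (N : ℤ) (NumberField.discr K))
    (hall : ∀ q : ℕ, q.Prime → q ∣ N → ∃ v' : HeightOneSpectrum (𝓞 ℚ), ((q : ℕ) : 𝓞 ℚ) ∈ v'.asIdeal ∧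
      ∃ 𝔓 ∈ v'.primesAbove, ∃ σ ∈ 𝔓.inertia (absoluteGaloisGroup ℚ), ∃ P : W.geomTorsion (p : ℤ), σ • P ≠ P)
    [Module (ZMod p) (Vp W K p)]
    (hrk : finrank (ZMod p) (AddSubgroup.toZModSubmodule p (selmerGroup (W.baseChange K) ((p ^ 1 : ℕ) : ℤ))) = 1)
    (hNV : B.HasUnitLambda N) : z 0 1 ≠ 0 :=
  limitBaseClass_layer_zero_one_ne_zero_of_hasUnitLambda_of_finrank_eq_one hB hz hS hloc
    (not_dvd_localTamagawaNumber_of_allRamified W hS.isImaginaryQuadratic.1 (Fact.out : p.Prime) h5 hN hND hall)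
    hN h5 hsurj hH hsp hND hall hrk hNV

end Assembly

/-! ## §4 The rank-one dictionary on the all-ramified cell — (Tam) removed (appended, gen 30) -/

section DictionaryAllRamified

variable {K : Type} [Field K] [NumberField K] (W : WeierstrassCurve ℚ) [W.IsElliptic] [W.IsGloballyMinimal] {p : ℕ} [Fact p.Prime]
  (κ : ZpExtension K p) {𝔭 𝔭' : HeightOneSpectrum (𝓞 K)}

/-- **The rank-one dictionary on the all-ramified cell, (Tam) discharged**: `T X ∈ Sel^ε_1(K_0, E[p]) ⟺ X ∈ Sel_p(E/K)` for every
`X ∈ H¹(K, E[p])`, given the `Setting`, (Heeg) for `N_E`, the named print fact {HLV 2022 Lemma 3.7, local form}, `N = N_E`, `(N, d_K) = 1`, `p ≥ 5`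
and binder (ii) «`E[p]` ramified at every `q ∣ N`» (`…RankOneTamagawa.resH1Hom_layerZero_mem_signedOrdSelmerTorsion_one_iff_mem_selmerGroup_of_tam`
with (Tam) supplied by §2) — the form a composition edge on cell β can call, binder (ii) being in hand there.
[cite: CastellaEtAl2025, §7.2, Thm. 7.1 (ii) (arXiv:2308.10474v2 pp. 29–30)] [cite: HatleyLeiVigni2022, Lemma 3.7] [cite: SilvermanATAEC1994, Cor. IV.9.2(d)] -/
theorem resH1Hom_layerZero_mem_signedOrdSelmerTorsion_one_iff_mem_selmerGroup_of_allRamified (hS : Setting W K p κ 𝔭 𝔭')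
    (hH : SatisfiesHeegnerHypothesis (W.conductorNorm ℤ) K) (hloc : hatleyLeiVigni2022_lemma37_local_signedCondition_eq_kummer W K p κ 𝔭 𝔭')
    (h5 : 5 ≤ p) {N : ℕ} (hN : (N : ℤ) = W.conductorNorm ℤ) (hND : IsCoprime (N : ℤ) (NumberField.discr K))
    (hall : ∀ q : ℕ, q.Prime → q ∣ N → ∃ v' : HeightOneSpectrum (𝓞 ℚ), ((q : ℕ) : 𝓞 ℚ) ∈ v'.asIdeal ∧
      ∃ 𝔓 ∈ v'.primesAbove, ∃ σ ∈ 𝔓.inertia (absoluteGaloisGroup ℚ), ∃ P : W.geomTorsion (p : ℤ), σ • P ≠ P)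
    (ε : ℤˣ) (X : Vp W K p) :
    resH1Hom (Literature.NumberTheory.EllipticCurves.subgroupIncl (κ.layerSubgroup 0))
        (AddSubgroup.inclusion (geomTorsion_natCast_pow_one W (K := K) (p := p)).le) (fun _ _ ↦ rfl) X ∈
        signedOrdSelmerTorsion (W.baseChange K) p κ ε 1 0 1 ↔
      X ∈ selmerGroup (W.baseChange K) ((p ^ 1 : ℕ) : ℤ) :=
  resH1Hom_layerZero_mem_signedOrdSelmerTorsion_one_iff_mem_selmerGroup_of_tam W κ hS hH hloc
    (not_dvd_localTamagawaNumber_of_allRamified W hS.isImaginaryQuadratic.1 (Fact.out : p.Prime) h5 hN hND hall) ε X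

end DictionaryAllRamified

end Summit.BirchSwinnertonDyer.BirchSwinnertonDyer.Theorems.SignedBaseChangeAcDivAdmdefTamagawaOfAllRamified

end
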